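import Mathlib
import HarnessLib
import Summits.HubbardSuperconductivity.HubbardSuperconductivity.Theorems.KLProgrammeKLRegimeEngineLastStepAliasRows

/-!
# K3 gen-8-FLOW (stmt 20437, stub (C), located item #20, cure (δ′) «LAST-STEP SWAP», layer F3g⁗): THE LAST-STEP ALIAS ROWS WITH THE `√Rsq` ENVELOPE —
# `E = (4+Ξ)+1 ≤ 2^11·√(klEngRsq R)`, so the order-26 row price carries `klEngRsq R⁴` instead of `klEngRsq R⁸`

Cell gate-hubbard-kl, seat p2 g20 («klLastRespU-MARGIN» cure of the located one-power caveat, memo LASTRESP-MARGIN-p2g20.md §2(c)).  `…EngineAliasVolume.envelopeE_le`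
bounds the closed envelope by `2^11·klEngRsq R` via `Gfr_j ≤ Rsq`; since `klEngRsq R = 1 + cr² + cz² + Σ_{j<5} Gfr_j²` one has `Gfr_j ≤ √Rsq`, hence
`E ≤ 2^11·√Rsq` and every `Rsq⁸` of `…LastStepAliasRows` becomes `√Rsq⁸ = Rsq⁴` — which puts the alias sizes `ZA_X` of the (δ′) door UNDER the `Rsq⁸` of
`klLastRespU⁻¹ = 2^256·Psq⁴·Rsq⁸·(E3Acum²+1)²` for EVERY `R` (no `Rsq ≤ 2^384` proviso).

* §1 `gfr_le_sqrt_klEngRsq`, `envelopeE_le_sqrt`, `gevreyRow26_le_of_le` (the row price for any `E ≤ 2^11·S`, `0 ≤ S`), `lastAliasLawSqrt`;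
* §2 `lastAliasRowA_le_sqrt` (`≤ √Rsq⁸·U³/(2^17β²)`), §3 `lastAliasRowB_le_sqrt` (`≤ Mm·√Rsq⁸U¹⁸/(2⁶β²) + Ms·U⁴/(2^217β¹²)`) — same literal left-hand sides as
  `lastAliasRowA_le/B_le` (their `_nonneg` twins apply verbatim).

Proofs = those of `…LastStepAliasRows` with `Rsq := √(klEngRsq R)`.  No definitions; nothing asserts superconductivity.
References: BGM 2006 §2.3 (2.21)–(2.24) [cite: BenfattoGiulianiMastropietro2006].
-/

noncomputable section

namespace Summit.HubbardSuperconductivity.HubbardSuperconductivity.Theorems.EngineV8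

set_option linter.dupNamespace false -- summit = problem name (single-conjunct summit), D-0017

open Real Finset Literature.MathematicalPhysics.QuantumLattice Literature.Probability.LatticeModels
open Summit.HubbardSuperconductivity.HubbardSuperconductivity.Theorems.KLRegimeSplit
open Summit.HubbardSuperconductivity.HubbardSuperconductivity.Theorems.DispersionFlow
open Summit.HubbardSuperconductivity.HubbardSuperconductivity.Theorems.KLProgrammeLegKernels
open scoped Nat

/-! ## §1 The `√Rsq` envelope and the row price -/

/-- `Gfr_j ≤ √(klEngRsq R)` for `j < 5` (`klEngRsq R = 1 + cr² + cz² + Σ_{j<5} Gfr_j²`, `0 ≤ Gfr_j`). -/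
theorem gfr_le_sqrt_klEngRsq {R : RenConsts} (hR : ∀ j, 0 ≤ R.Gfr j) {j : ℕ} (hj : j < 5) : R.Gfr j ≤ Real.sqrt (klEngRsq R) := by
  have h1 : R.Gfr j ^ 2 ≤ ∑ i ∈ range 5, R.Gfr i ^ 2 := single_le_sum (f := fun i => R.Gfr i ^ 2) (fun i _ => sq_nonneg (R.Gfr i)) (mem_range.2 hj)
  have h2 : R.Gfr j ^ 2 ≤ klEngRsq R := by
    unfold klEngRsq
    nlinarith [sq_nonneg R.cr, sq_nonneg R.cz]
  calc R.Gfr j = Real.sqrt (R.Gfr j ^ 2) := (Real.sqrt_sq (hR j)).symm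
    _ ≤ Real.sqrt (klEngRsq R) := Real.sqrt_le_sqrt h2

/-- **The envelope size at the closed choice, `√Rsq` form**: under the `U`-door `Gfr₀|U| + (Σ_{j<5}Gfr_j + π⁸W/2^{11})·U² ≤ 1/128`,
`(4 + Ξ) + 1 ≤ 2^{11}·√(klEngRsq R)`. [cite: BenfattoGiulianiMastropietro2006, §3 (3.2)] -/
theorem envelopeE_le_sqrt {R : RenConsts} (hR : ∀ j, 0 ≤ R.Gfr j) {W U : ℝ}
    (hdoor : R.Gfr 0 * |U| + ((∑ j ∈ range 5, R.Gfr j) + Real.pi ^ 8 * W / 2 ^ 11) * U ^ 2 ≤ 1 / 128) :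
    (4 + (2 ^ 10 * (1 + Real.pi ^ 8 * (W * U ^ 2) / 2 ^ 11) + ∑ j ∈ range 5, R.Gfr j)) + 1 ≤ 2 ^ 11 * Real.sqrt (klEngRsq R) := by
  have hS : ∑ j ∈ range 5, R.Gfr j ≤ ∑ _j ∈ range 5, Real.sqrt (klEngRsq R) := sum_le_sum fun j hj => gfr_le_sqrt_klEngRsq hR (mem_range.1 hj)
  rw [sum_const, card_range, nsmul_eq_mul] at hS
  have hS0 : 0 ≤ ∑ j ∈ range 5, R.Gfr j := sum_nonneg fun j _ => hR j
  have hR1 : 1 ≤ Real.sqrt (klEngRsq R) := Real.one_le_sqrt.mpr (one_le_klEngRsq R)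
  have h0 : 0 ≤ R.Gfr 0 * |U| := mul_nonneg (hR 0) (abs_nonneg U)
  have hSU : 0 ≤ (∑ j ∈ range 5, R.Gfr j) * U ^ 2 := mul_nonneg hS0 (sq_nonneg U)
  have hx : Real.pi ^ 8 * (W * U ^ 2) / 2 ^ 11 ≤ 1 / 128 := by
    have he : Real.pi ^ 8 * (W * U ^ 2) / 2 ^ 11 = Real.pi ^ 8 * W / 2 ^ 11 * U ^ 2 := by ring
    rw [he]; nlinarith
  push_cast at hS
  nlinarith

/-- **THE ORDER-26 ROW PRICE for any envelope scale**: `E ≤ 2^11·S`, `0 ≤ E`: `(26!)²·(2^22Eβ²)⁸·(U/(2^26β))¹⁸ ≤ S⁸·U¹⁸/(2^27·β²)`.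
[cite: BenfattoGiulianiMastropietro2006, §2.3 (2.24)] -/
theorem gevreyRow26_le_of_le {β U E S : ℝ} (hβ : klBetaMin ≤ β) (hE0 : 0 ≤ E) (hE : E ≤ 2 ^ 11 * S) :
    ((26 ! : ℝ)) ^ 2 * (2 ^ 22 * E * β ^ 2) ^ 8 * (U / (2 ^ 26 * β)) ^ 18 ≤ S ^ 8 * U ^ 18 / (2 ^ 27 * β ^ 2) := by
  have h128 : (128 : ℝ) ≤ β := by simpa [klBetaMin] using hβ
  have hβ0 : (0 : ℝ) < β := by linarith
  have hfac : ((26 ! : ℝ)) ^ 2 ≤ 2 ^ 177 := by norm_num [Nat.factorial]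
  have hE8 : E ^ 8 ≤ (2 ^ 11 * S) ^ 8 := pow_le_pow_left₀ hE0 hE 8
  have heq : ((26 ! : ℝ)) ^ 2 * (2 ^ 22 * E * β ^ 2) ^ 8 * (U / (2 ^ 26 * β)) ^ 18 =
      (((26 ! : ℝ)) ^ 2 * E ^ 8 / (2 ^ 146 * 2 ^ 146)) * (U ^ 18 / β ^ 2) := by
    rw [div_pow, mul_pow, mul_pow]
    field_simp
  have heq2 : S ^ 8 * U ^ 18 / (2 ^ 27 * β ^ 2) = (S ^ 8 / 2 ^ 27) * (U ^ 18 / β ^ 2) := by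
    rw [mul_comm (2 ^ 27 : ℝ) (β ^ 2), ← div_div, mul_div_assoc, div_mul_eq_mul_div, mul_div_assoc]
  rw [heq, heq2]
  refine mul_le_mul_of_nonneg_right ?_ (by positivity)
  rw [div_le_div_iff₀ (by positivity) (by positivity)]
  calc ((26 ! : ℝ)) ^ 2 * E ^ 8 * 2 ^ 27 ≤ 2 ^ 177 * (2 ^ 11 * S) ^ 8 * 2 ^ 27 := by gcongr
    _ = S ^ 8 * (2 ^ 146 * 2 ^ 146) := by ring

/-- **The alias law at the last step with the `√Rsq` envelope**: as `lastAliasLaw`, last conjunct `(4+Ξ)+1 ≤ 2^11·√(klEngRsq R)`.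
[cite: BenfattoGiulianiMastropietro2006, §2.3 (2.24)] -/
theorem lastAliasLawSqrt {P : SplitConsts} {R : RenConsts} (hR : ∀ j, 0 ≤ R.Gfr j) {W : ℝ} (hW : 0 ≤ W) {β U Ξ : ℝ} (hβ : klBetaMin ≤ β) (hU : 0 < U)
    (hΞ : Ξ = (2 ^ 10 * (1 + Real.pi ^ 8 * (W * U ^ 2) / 2 ^ 11) + ∑ j ∈ range 5, R.Gfr j))
    (hdoor : R.Gfr 0 * |U| + ((∑ j ∈ range 5, R.Gfr j) + Real.pi ^ 8 * W / 2 ^ 11) * U ^ 2 ≤ 1 / 128) {L : ℕ} (hL : klEngL4Real P R β U ≤ L)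
    {m : ℕ} (hm : m ≤ nScales β + 1) {ρ : ℝ} (hρ : ρ ≤ 2 ^ 31 * ((4 + Ξ) + 1) * (16 : ℝ) ^ m) :
    ρ * (2 / ((2 * (L / 4 + 1) : ℕ) : ℝ)) ≤ U / (2 ^ 26 * β) ∧ ρ ≤ 2 ^ 22 * ((4 + Ξ) + 1) * β ^ 2 ∧ 0 ≤ (4 + Ξ) + 1 ∧
      (4 + Ξ) + 1 ≤ 2 ^ 11 * Real.sqrt (klEngRsq R) := by
  subst hΞ
  have hE0 : 0 ≤ (4 + (2 ^ 10 * (1 + Real.pi ^ 8 * (W * U ^ 2) / 2 ^ 11) + ∑ j ∈ range 5, R.Gfr j)) + 1 := by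
    have := Xi_nonneg hR hW U; linarith
  exact ⟨aliasRatio_mul_two_div_le_closed (P := P) hR hW hβ hU hdoor hL hm hρ, aliasRatio_le_sq_beta hβ hm hE0 hρ, hE0, envelopeE_le_sqrt hR hdoor⟩

section Rows

variable {P : SplitConsts} {R : RenConsts} (hR : ∀ j, 0 ≤ R.Gfr j) (hR0 : 0 < R.Gfr 0) {W : ℝ} (hW : 0 ≤ W) {β U : ℝ} (hβ : klBetaMin ≤ β)
  (hU : 0 < U) (hU1 : U ≤ 1) {Ξ Θ : ℝ}
  (hΞ : Ξ = (2 ^ 10 * (1 + Real.pi ^ 8 * (W * U ^ 2) / 2 ^ 11) + ∑ j ∈ range 5, R.Gfr j))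
  (hΘ : Θ = (1 + ((∑ j ∈ range 5, R.Gfr j) + Real.pi ^ 8 * W / 2 ^ 11) * |U| / R.Gfr 0))
  (hdoor : R.Gfr 0 * |U| + ((∑ j ∈ range 5, R.Gfr j) + Real.pi ^ 8 * W / 2 ^ 11) * U ^ 2 ≤ 1 / 512) {L : ℕ} [NeZero L] (hL : klEngL₄ P R β U ≤ L)
  {s : ℕ} (hs : 10 ≤ s) {j : ℕ} (hj : j ≤ 4)
include hR hR0 hW hβ hU hU1 hΞ hΘ hdoor hL hs hj

/-! ## §2 Channel `a`, `√Rsq` form -/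

/-- **The channel-`a` alias row at `Mg = 26`, `√Rsq` form**: `≤ √(klEngRsq R)⁸·U³/(2^17·β²)`. [cite: BenfattoGiulianiMastropietro2006, §2.3 (2.24)] -/
theorem lastAliasRowA_le_sqrt :
    2 * (2 * (1 * ((3 : ℝ) ^ j * (((R.Gfr 0 * |U| * Θ * ((16 : ℝ) ^ nScales β)⁻¹) * (R.Gfr 0 * |U| * Θ * ((16 : ℝ) ^ nScales β)⁻¹) / |(β * (L : ℝ) ^ 2)|) * ((5 : ℝ) * (|(β * (L : ℝ)
      ^ 2)| * (6 / (klScale klE0 (nScales β + 1))))) * ((26 ! : ℝ)) ^ 2 * (2 * (2 * (2 ^ 10 * (1 : ℝ) * (4 : ℝ) ^ nScales β) + 2 * (4 * (2 * (4 * (4 + (4 : ℝ) ^ nScales β * Ξ) * (1 +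
      16 * (1 + (27 / 10 : ℝ)) / (klScale klE0 (nScales β + 1)) * 1) + (2 ^ 10 * (1 : ℝ) * (4 : ℝ) ^ nScales β))) * (1 + 6 / (klScale klE0 (nScales β + 1)) * ((klScale klE0 (nScales β
      + 1)) / 128 + (5 : ℝ) * (R.Gfr 0 * |U| * Θ * ((16 : ℝ) ^ nScales β)⁻¹)))))) ^ 26) * (2 / ((2 * (L / 4 + 1) : ℕ) : ℝ)) ^ (26 - j - 4) * (2 ^ 2 * ∑' k : Fin 2 → ℤ, ∏ i, (1 + (k i :
      ℝ) ^ 2)⁻¹)))) + (L : ℝ) ^ 2 * (L : ℝ) ^ j * ((((R.Gfr 0 * |U| * Θ * ((16 : ℝ) ^ nScales β)⁻¹) * (R.Gfr 0 * |U| * Θ * ((16 : ℝ) ^ nScales β)⁻¹) / |(β * (L : ℝ) ^ 2)|) * ((5 : ℝ) *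
      (|(β * (L : ℝ) ^ 2)| * (6 / (klScale klE0 (nScales β + 1))))) * ((0 ! : ℝ)) ^ 2 * (2 * (2 * (2 ^ 10 * (1 : ℝ) * (4 : ℝ) ^ nScales β) + 2 * (4 * (2 * (4 * (4 + (4 : ℝ) ^ nScales β
      * Ξ) * (1 + 16 * (1 + (27 / 10 : ℝ)) / (klScale klE0 (nScales β + 1)) * 1) + (2 ^ 10 * (1 : ℝ) * (4 : ℝ) ^ nScales β))) * (1 + 6 / (klScale klE0 (nScales β + 1)) * ((klScale klE0
      (nScales β + 1)) / 128 + (5 : ℝ) * (R.Gfr 0 * |U| * Θ * ((16 : ℝ) ^ nScales β)⁻¹)))))) ^ 0) * (1 / (1 + (L : ℝ) / 4) ^ s)) ≤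
      Real.sqrt (klEngRsq R) ^ 8 * U ^ 3 / (2 ^ 17 * β ^ 2) := by
  have h128 : (128 : ℝ) ≤ β := by simpa [klBetaMin] using hβ
  have hβ0 : (0 : ℝ) < β := by linarith
  have hLr := klEngL4Real_le_of_klEngL₄_le hL
  have hL4 := four_le_of_klEngL4Real_le hβ hU hU1 hLr
  have hPR : 1 ≤ klEngPsq P ^ 2 * klEngRsq R ^ 2 := one_le_mul_of_one_le_of_one_le (one_le_pow₀ (one_le_klEngPsq P)) (one_le_pow₀ (one_le_klEngRsq R))
  have hX : U / (2 ^ 59 * klEngPsq P ^ 2 * klEngRsq R ^ 2 * β ^ 3) ≤ U / (2 ^ 59 * β ^ 3) := by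
    refine div_le_div_of_nonneg_left hU.le (by positivity) ?_
    nlinarith [pow_pos hβ0 3]
  have hX0 : 0 ≤ U / (2 ^ 59 * klEngPsq P ^ 2 * klEngRsq R ^ 2 * β ^ 3) := by
    have hPRp : 0 < klEngPsq P ^ 2 * klEngRsq R ^ 2 := mul_pos (pow_pos (klEngPsq_pos P) 2) (pow_pos (klEngRsq_pos R) 2)
    have hden : 0 < 2 ^ 59 * klEngPsq P ^ 2 * klEngRsq R ^ 2 * β ^ 3 := by
      have := mul_pos (mul_pos hPRp (pow_pos hβ0 3)) (by norm_num : (0 : ℝ) < 2 ^ 59); linarith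
    exact div_nonneg hU.le hden.le
  have hRsq1 : 1 ≤ Real.sqrt (klEngRsq R) := Real.one_le_sqrt.mpr (one_le_klEngRsq R)
  have hΞ0 : 0 ≤ Ξ := by rw [hΞ]; exact Xi_nonneg hR hW U
  have hΘ0 : 0 ≤ Θ := by rw [hΘ]; exact Theta_nonneg hR hR0 hW U
  have hδΛ : R.Gfr 0 * |U| * Θ * ((16 : ℝ) ^ nScales β)⁻¹ ≤ klScale klE0 (nScales β + 1) / 4 := by
    rw [hΘ]; exact Gfr_mul_Theta_inv_pow_le_klScale_succ_div_four hR0 hdoor (nScales β)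
  have hT : R.Gfr 0 * |U| * Θ ≤ 1 / 512 := by rw [hΘ, Gfr_mul_abs_mul_Theta_eq hR0]; exact hdoor
  have hc : (β * (L : ℝ) ^ 2) ≠ 0 := by
    have hL1 : (1 : ℝ) ≤ L := by exact_mod_cast Nat.one_le_iff_ne_zero.2 (NeZero.ne L)
    positivity
  obtain ⟨hPa, hPa0⟩ := lastPrefA_le (c := (β * (L : ℝ) ^ 2)) (hR 0) hc hΘ0 (nScales β) hδΛ hT
  have hρ := lastRatio₃_le (hR 0) hΞ0 hΘ0 zero_le_one (nScales β) hδΛ (U := U)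
  have hρ0 := lastRatio₃_nonneg (hR 0) hΞ0 hΘ0 zero_le_one (nScales β) hδΛ (U := U)
  obtain ⟨hρr, hρB, hE0, hE⟩ := lastAliasLawSqrt (P := P) hR hW hβ hU hΞ (hdoor.trans (by norm_num)) hLr (Nat.le_succ _) hρ
  have hQ := gevreyRow26_le_of_le (U := U) hβ hE0 hE
  obtain ⟨hS, hS0⟩ := aliasS_le
  obtain ⟨hr1, hr0⟩ := aliasR_le_one L
  have halias := aliasPartA_le hj hPa0 hPa hρ0 hr0 hr1 hρr hρB hS0 hS hQ
  have h4L := four_div_le_of_klEngL4Real_le (P := P) (R := R) hU hβ0 hLr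
  have hfar := farPartA_le hL4 hPa0 hPa hj hs h4L
    (ρ := (2 * (2 * (2 ^ 10 * (1 : ℝ) * (4 : ℝ) ^ nScales β) + 2 * (4 * (2 * (4 * (4 + (4 : ℝ) ^ nScales β * Ξ) * (1 + 16 * (1 + (27 / 10 : ℝ)) / (klScale klE0 (nScales β + 1)) * 1) + (2 ^
      10 * (1 : ℝ) * (4 : ℝ) ^ nScales β))) * (1 + 6 / (klScale klE0 (nScales β + 1)) * ((klScale klE0 (nScales β + 1)) / 128 + (5 : ℝ) * (R.Gfr 0 * |U| * Θ * ((16 : ℝ) ^ nScales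
      β)⁻¹)))))))
  have hrow := rowBoundA_le (Rsq := Real.sqrt (klEngRsq R)) hRsq1 hU.le hU1 h128 hX0 hX
  exact (add_le_add halias hfar).trans hrow

/-! ## §3 Channels `b` and `c`, `√Rsq` form -/

/-- **The channel-`b`/`c` alias row at `Mg = 26`, `√Rsq` form**: `≤ Mm·(√(klEngRsq R)⁸U¹⁸/(2⁶β²)) + Ms·(U⁴/(2^217β¹²))`.
[cite: BenfattoGiulianiMastropietro2006, §2.3 (2.24)] -/
theorem lastAliasRowB_le_sqrt {Mm Ms : ℝ} (hMm : 0 ≤ Mm) (hMs : 0 ≤ Ms) :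
    2 * (2 * (Mm * ((3 : ℝ) ^ j * (((R.Gfr 0 * |U| * Θ * ((16 : ℝ) ^ nScales β)⁻¹) / |(β * (L : ℝ) ^ 2)| * ((5 : ℝ) * (|(β * (L : ℝ) ^ 2)| * (6 / (klScale klE0 (nScales β + 1)))))) *
      ((R.Gfr 0 * |U| * Θ * ((16 : ℝ) ^ nScales β)⁻¹) / |(β * (L : ℝ) ^ 2)| * ((5 : ℝ) * (|(β * (L : ℝ) ^ 2)| * (6 / (klScale klE0 (nScales β + 1)))))) * ((26 ! : ℝ)) ^ 2 * (2 * (2 *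
      (2 * (2 ^ 10 * (1 : ℝ) * (4 : ℝ) ^ nScales β) + 2 * (4 * (2 * (4 * (4 + (4 : ℝ) ^ nScales β * Ξ) * (1 + 16 * (1 + (27 / 10 : ℝ)) / (klScale klE0 (nScales β + 1)) * 1) + (2 ^ 10 *
      (1 : ℝ) * (4 : ℝ) ^ nScales β))) * (1 + 6 / (klScale klE0 (nScales β + 1)) * ((klScale klE0 (nScales β + 1)) / 128 + (5 : ℝ) * (R.Gfr 0 * |U| * Θ * ((16 : ℝ) ^ nScales
      β)⁻¹))))))) ^ 26 + 2 * (((R.Gfr 0 * |U| * Θ * ((16 : ℝ) ^ nScales β)⁻¹) / |(β * (L : ℝ) ^ 2)|) * ((5 : ℝ) * (|(β * (L : ℝ) ^ 2)| * (6 / (klScale klE0 (nScales β + 1))))) * ((26 !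
      : ℝ)) ^ 2 * (2 * (2 * (2 ^ 10 * (1 : ℝ) * (4 : ℝ) ^ nScales β) + 2 * (4 * (2 * (4 * (4 + (4 : ℝ) ^ nScales β * Ξ) * (1 + 16 * (1 + (27 / 10 : ℝ)) / (klScale klE0 (nScales β + 1))
      * 1) + (2 ^ 10 * (1 : ℝ) * (4 : ℝ) ^ nScales β))) * (1 + 6 / (klScale klE0 (nScales β + 1)) * ((klScale klE0 (nScales β + 1)) / 128 + (5 : ℝ) * (R.Gfr 0 * |U| * Θ * ((16 : ℝ) ^
      nScales β)⁻¹)))))) ^ 26)) * (2 / ((2 * (L / 4 + 1) : ℕ) : ℝ)) ^ (26 - j - 4) * (2 ^ 2 * ∑' k : Fin 2 → ℤ, ∏ i, (1 + (k i : ℝ) ^ 2)⁻¹)))) + (L : ℝ) ^ 2 * (L : ℝ) ^ j * ((((R.Gfr 0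
      * |U| * Θ * ((16 : ℝ) ^ nScales β)⁻¹) / |(β * (L : ℝ) ^ 2)| * ((5 : ℝ) * (|(β * (L : ℝ) ^ 2)| * (6 / (klScale klE0 (nScales β + 1)))))) * ((R.Gfr 0 * |U| * Θ * ((16 : ℝ) ^
      nScales β)⁻¹) / |(β * (L : ℝ) ^ 2)| * ((5 : ℝ) * (|(β * (L : ℝ) ^ 2)| * (6 / (klScale klE0 (nScales β + 1)))))) * ((0 ! : ℝ)) ^ 2 * (2 * (2 * (2 * (2 ^ 10 * (1 : ℝ) * (4 : ℝ) ^
      nScales β) + 2 * (4 * (2 * (4 * (4 + (4 : ℝ) ^ nScales β * Ξ) * (1 + 16 * (1 + (27 / 10 : ℝ)) / (klScale klE0 (nScales β + 1)) * 1) + (2 ^ 10 * (1 : ℝ) * (4 : ℝ) ^ nScales β))) *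
      (1 + 6 / (klScale klE0 (nScales β + 1)) * ((klScale klE0 (nScales β + 1)) / 128 + (5 : ℝ) * (R.Gfr 0 * |U| * Θ * ((16 : ℝ) ^ nScales β)⁻¹))))))) ^ 0 + 2 * (((R.Gfr 0 * |U| * Θ *
      ((16 : ℝ) ^ nScales β)⁻¹) / |(β * (L : ℝ) ^ 2)|) * ((5 : ℝ) * (|(β * (L : ℝ) ^ 2)| * (6 / (klScale klE0 (nScales β + 1))))) * ((0 ! : ℝ)) ^ 2 * (2 * (2 * (2 ^ 10 * (1 : ℝ) * (4 :
      ℝ) ^ nScales β) + 2 * (4 * (2 * (4 * (4 + (4 : ℝ) ^ nScales β * Ξ) * (1 + 16 * (1 + (27 / 10 : ℝ)) / (klScale klE0 (nScales β + 1)) * 1) + (2 ^ 10 * (1 : ℝ) * (4 : ℝ) ^ nScales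
      β))) * (1 + 6 / (klScale klE0 (nScales β + 1)) * ((klScale klE0 (nScales β + 1)) / 128 + (5 : ℝ) * (R.Gfr 0 * |U| * Θ * ((16 : ℝ) ^ nScales β)⁻¹)))))) ^ 0)) * (Ms / (1 + (L : ℝ)
      / 4) ^ s)) ≤
      Mm * (Real.sqrt (klEngRsq R) ^ 8 * U ^ 18 / (2 ^ 6 * β ^ 2)) + Ms * (U ^ 4 / (2 ^ 217 * β ^ 12)) := by
  have h128 : (128 : ℝ) ≤ β := by simpa [klBetaMin] using hβ
  have hβ0 : (0 : ℝ) < β := by linarith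
  have hLr := klEngL4Real_le_of_klEngL₄_le hL
  have hL4 := four_le_of_klEngL4Real_le hβ hU hU1 hLr
  have hPR : 1 ≤ klEngPsq P ^ 2 * klEngRsq R ^ 2 := one_le_mul_of_one_le_of_one_le (one_le_pow₀ (one_le_klEngPsq P)) (one_le_pow₀ (one_le_klEngRsq R))
  have hX : U / (2 ^ 59 * klEngPsq P ^ 2 * klEngRsq R ^ 2 * β ^ 3) ≤ U / (2 ^ 59 * β ^ 3) := by
    refine div_le_div_of_nonneg_left hU.le (by positivity) ?_
    nlinarith [pow_pos hβ0 3]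
  have hX0 : 0 ≤ U / (2 ^ 59 * klEngPsq P ^ 2 * klEngRsq R ^ 2 * β ^ 3) := by
    have hPRp : 0 < klEngPsq P ^ 2 * klEngRsq R ^ 2 := mul_pos (pow_pos (klEngPsq_pos P) 2) (pow_pos (klEngRsq_pos R) 2)
    have hden : 0 < 2 ^ 59 * klEngPsq P ^ 2 * klEngRsq R ^ 2 * β ^ 3 := by
      have := mul_pos (mul_pos hPRp (pow_pos hβ0 3)) (by norm_num : (0 : ℝ) < 2 ^ 59); linarith
    exact div_nonneg hU.le hden.le
  have hΞ0 : 0 ≤ Ξ := by rw [hΞ]; exact Xi_nonneg hR hW U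
  have hΘ0 : 0 ≤ Θ := by rw [hΘ]; exact Theta_nonneg hR hR0 hW U
  have hδΛ : R.Gfr 0 * |U| * Θ * ((16 : ℝ) ^ nScales β)⁻¹ ≤ klScale klE0 (nScales β + 1) / 4 := by
    rw [hΘ]; exact Gfr_mul_Theta_inv_pow_le_klScale_succ_div_four hR0 hdoor (nScales β)
  have hc : (β * (L : ℝ) ^ 2) ≠ 0 := by
    have hL1 : (1 : ℝ) ≤ L := by exact_mod_cast Nat.one_le_iff_ne_zero.2 (NeZero.ne L)
    positivity
  obtain ⟨hPb, hPb0⟩ := lastPrefB_le (c := (β * (L : ℝ) ^ 2)) (hR 0) hc hΘ0 (nScales β) hδΛ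
  have hρ3 := lastRatio₃_le (hR 0) hΞ0 hΘ0 zero_le_one (nScales β) hδΛ (U := U)
  have hρ30 := lastRatio₃_nonneg (hR 0) hΞ0 hΘ0 zero_le_one (nScales β) hδΛ (U := U)
  have hρ4 := lastRatio₄_le (hR 0) hΞ0 hΘ0 zero_le_one (nScales β) hδΛ (U := U)
  have hρ40 : 0 ≤ 2 * (2 * (2 * (2 ^ 10 * (1 : ℝ) * (4 : ℝ) ^ nScales β) + 2 * (4 * (2 * (4 * (4 + (4 : ℝ) ^ nScales β * Ξ) * (1 + 16 * (1 + (27 / 10 : ℝ)) / (klScale klE0 (nScales β + 1)) * 1) + (2 ^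
      10 * (1 : ℝ) * (4 : ℝ) ^ nScales β))) * (1 + 6 / (klScale klE0 (nScales β + 1)) * ((klScale klE0 (nScales β + 1)) / 128 + (5 : ℝ) * (R.Gfr 0 * |U| * Θ * ((16 : ℝ) ^ nScales
      β)⁻¹)))))) := mul_nonneg (by norm_num) hρ30
  obtain ⟨hρ3r, hρ3B, hE0, hE⟩ := lastAliasLawSqrt (P := P) hR hW hβ hU hΞ (hdoor.trans (by norm_num)) hLr (Nat.le_succ _) hρ3
  obtain ⟨hρ4r, hρ4B, -, -⟩ := lastAliasLawSqrt (P := P) hR hW hβ hU hΞ (hdoor.trans (by norm_num)) hLr (Nat.le_succ _) hρ4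
  have hQ := gevreyRow26_le_of_le (U := U) hβ hE0 hE
  obtain ⟨hS, hS0⟩ := aliasS_le
  obtain ⟨hr1, hr0⟩ := aliasR_le_one L
  have halias := aliasPartB_le hj hPb0 hPb hρ30 hρ40 hr0 hr1 hρ3r hρ3B hρ4r hρ4B hS0 hS hQ hMm
  have h4L := four_div_le_of_klEngL4Real_le (P := P) (R := R) hU hβ0 hLr
  have hfar := farPartB_le hL4 hPb0 hPb hMs hj hs h4L
    (ρ₃ := (2 * (2 * (2 ^ 10 * (1 : ℝ) * (4 : ℝ) ^ nScales β) + 2 * (4 * (2 * (4 * (4 + (4 : ℝ) ^ nScales β * Ξ) * (1 + 16 * (1 + (27 / 10 : ℝ)) / (klScale klE0 (nScales β + 1)) * 1) + (2 ^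
      10 * (1 : ℝ) * (4 : ℝ) ^ nScales β))) * (1 + 6 / (klScale klE0 (nScales β + 1)) * ((klScale klE0 (nScales β + 1)) / 128 + (5 : ℝ) * (R.Gfr 0 * |U| * Θ * ((16 : ℝ) ^ nScales
      β)⁻¹)))))))
    (ρ₄ := 2 * (2 * (2 * (2 ^ 10 * (1 : ℝ) * (4 : ℝ) ^ nScales β) + 2 * (4 * (2 * (4 * (4 + (4 : ℝ) ^ nScales β * Ξ) * (1 + 16 * (1 + (27 / 10 : ℝ)) / (klScale klE0 (nScales β + 1)) * 1) + (2 ^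
      10 * (1 : ℝ) * (4 : ℝ) ^ nScales β))) * (1 + 6 / (klScale klE0 (nScales β + 1)) * ((klScale klE0 (nScales β + 1)) / 128 + (5 : ℝ) * (R.Gfr 0 * |U| * Θ * ((16 : ℝ) ^ nScales
      β)⁻¹)))))))
  have hrow := rowBoundB_le (Rsq := Real.sqrt (klEngRsq R)) (Mm := Mm) (Ms := Ms) h128 hX0 hX hMm hMs
  exact (add_le_add halias hfar).trans hrow

end Rows

end Summit.HubbardSuperconductivity.HubbardSuperconductivity.Theorems.EngineV8

end
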